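import Mathlib
import HarnessLib
import Summits.ValiantsHypothesis.ValiantsHypothesis.Theorems.MonotoneRestorationOrbitRestorationLinearVolumeQPDiUnfoldingCertificate

/-!
# Route MonotoneRestoration — aside `OrbitRestorationLinearVolumeQP` (stmt-ValiantsHypothesis-18294):
# ONE-SORTED `k`-LABEL UNFOLDING, part 2/3 — GLUING and FORGETTING preserve the elimination-ordering certificate

Companion of `…DiUnfoldingCertificate.lean` (the certificate `N` of a labelled pattern on `Fin k ⊕ Fin m` and
its treewidth bound `treewidth_le_of_certificate`).  The two operations of the one-sorted graph algebra that
change the pattern: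

* `certificate_glue` — the product `mul e₁ e₂` GLUES the two patterns along their `k` labels: inner vertices
  `Fin (m₁ + m₂)` (`Fin.castAdd` / `Fin.natAdd`), edge multisets added, certificates pushed (`certificate_push`)
  and juxtaposed (`Fin.append`);
* `certificate_forget` — `sumLabel a e` FORGETS label `a`: the vertex holding `a` becomes the new inner vertex
  `Fin.natAdd m 0 : Fin (m + 1)`, LAST among the inner vertices in the reversed creation order (it was created
  before everything inside `e`), with the other `k - 1` label vertices as its designated higher neighbours, and a
  fresh isolated vertex takes label `a`.

Both preserve the six certificate conditions.  Def-free helper (`--supports stmt-ValiantsHypothesis-18294`);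
nothing here is a named fact; the stub, R1 and VP ≠ VNP are NOT moved.

References: Dawar–Pago–Seppelt 2025 (arXiv:2502.06740) §5, §7; Courcelle–Engelfriet 2012 §2.3.
-/

noncomputable section

open scoped Classical

-- `Summit.ValiantsHypothesis.ValiantsHypothesis.…` is the tree's single-conjunct layout (Sub = Summit).
set_option linter.dupNamespace false

namespace Summit.ValiantsHypothesis.ValiantsHypothesis.Theorems.DiUnfolding

open Summit.ValiantsHypothesis.ValiantsHypothesis.Theorems

variable {k m : ℕ}

/-! ### Gluing two certified labelled patterns along the labels -/

/-- **Gluing** (the `mul` of one-sorted expressions: same labels, disjoint inner vertices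
`Fin (m₁ + m₂)`, the first pattern's inner vertices before the second's, edge multisets added, the
certificates pushed and juxtaposed) preserves the certificate. [folklore] -/
theorem certificate_glue {m₁ m₂ : ℕ} (E₁ : Multiset ((Fin k ⊕ Fin m₁) × (Fin k ⊕ Fin m₁)))
    (N₁ : Fin m₁ → Finset (Fin k ⊕ Fin m₁))
    (E₂ : Multiset ((Fin k ⊕ Fin m₂) × (Fin k ⊕ Fin m₂))) (N₂ : Fin m₂ → Finset (Fin k ⊕ Fin m₂))
    (h1 : ∀ j, (N₁ j).card ≤ k - 1)
    (h2 : ∀ j j', Sum.inr j' ∈ N₁ j → j < j')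
    (h3a : ∀ (j : Fin m₁) (b : Fin k),
      ((Sum.inr j, Sum.inl b) ∈ E₁ ∨ (Sum.inl b, Sum.inr j) ∈ E₁) → Sum.inl b ∈ N₁ j)
    (h3b : ∀ j j' : Fin m₁,
      ((Sum.inr j, Sum.inr j') ∈ E₁ ∨ (Sum.inr j', Sum.inr j) ∈ E₁) → j < j' → Sum.inr j' ∈ N₁ j)
    (h4a : ∀ j j₁ j₂ : Fin m₁, Sum.inr j₁ ∈ N₁ j → Sum.inr j₂ ∈ N₁ j → j₁ < j₂ → Sum.inr j₂ ∈ N₁ j₁)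
    (h4b : ∀ (j j₁ : Fin m₁) (b : Fin k), Sum.inr j₁ ∈ N₁ j → Sum.inl b ∈ N₁ j → Sum.inl b ∈ N₁ j₁)
    (h1' : ∀ j, (N₂ j).card ≤ k - 1)
    (h2' : ∀ j j', Sum.inr j' ∈ N₂ j → j < j')
    (h3a' : ∀ (j : Fin m₂) (b : Fin k),
      ((Sum.inr j, Sum.inl b) ∈ E₂ ∨ (Sum.inl b, Sum.inr j) ∈ E₂) → Sum.inl b ∈ N₂ j)
    (h3b' : ∀ j j' : Fin m₂,
      ((Sum.inr j, Sum.inr j') ∈ E₂ ∨ (Sum.inr j', Sum.inr j) ∈ E₂) → j < j' → Sum.inr j' ∈ N₂ j)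
    (h4a' : ∀ j j₁ j₂ : Fin m₂, Sum.inr j₁ ∈ N₂ j → Sum.inr j₂ ∈ N₂ j → j₁ < j₂ → Sum.inr j₂ ∈ N₂ j₁)
    (h4b' : ∀ (j j₁ : Fin m₂) (b : Fin k), Sum.inr j₁ ∈ N₂ j → Sum.inl b ∈ N₂ j → Sum.inl b ∈ N₂ j₁)
    (E : Multiset ((Fin k ⊕ Fin (m₁ + m₂)) × (Fin k ⊕ Fin (m₁ + m₂))))
    (hE : E = E₁.map (Prod.map (Sum.map id (Fin.castAdd m₂)) (Sum.map id (Fin.castAdd m₂))) +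
      E₂.map (Prod.map (Sum.map id (Fin.natAdd m₁)) (Sum.map id (Fin.natAdd m₁))))
    (N : Fin (m₁ + m₂) → Finset (Fin k ⊕ Fin (m₁ + m₂)))
    (hN : N = Fin.append (fun j => (N₁ j).image (Sum.map id (Fin.castAdd m₂)))
      (fun j => (N₂ j).image (Sum.map id (Fin.natAdd m₁)))) :
    (∀ j, (N j).card ≤ k - 1) ∧
    (∀ j j', Sum.inr j' ∈ N j → j < j') ∧
    (∀ (j : Fin (m₁ + m₂)) (b : Fin k),
      ((Sum.inr j, Sum.inl b) ∈ E ∨ (Sum.inl b, Sum.inr j) ∈ E) → Sum.inl b ∈ N j) ∧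
    (∀ j j' : Fin (m₁ + m₂),
      ((Sum.inr j, Sum.inr j') ∈ E ∨ (Sum.inr j', Sum.inr j) ∈ E) → j < j' → Sum.inr j' ∈ N j) ∧
    (∀ j j₁ j₂ : Fin (m₁ + m₂), Sum.inr j₁ ∈ N j → Sum.inr j₂ ∈ N j → j₁ < j₂ → Sum.inr j₂ ∈ N j₁) ∧
    (∀ (j j₁ : Fin (m₁ + m₂)) (b : Fin k), Sum.inr j₁ ∈ N j → Sum.inl b ∈ N j → Sum.inl b ∈ N j₁) := by
  obtain ⟨A1, A2, A3a, A3b, A4a, A4b⟩ := certificate_push E₁ N₁ h1 h2 h3a h3b h4a h4b (Fin.castAdd m₂)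
    (Fin.strictMono_castAdd m₂) N (fun j => by rw [hN, Fin.append_left])
  obtain ⟨B1, B2, B3a, B3b, B4a, B4b⟩ := certificate_push E₂ N₂ h1' h2' h3a' h3b' h4a' h4b'
    (Fin.natAdd m₁) (Fin.strictMono_natAdd m₁) N (fun j => by rw [hN, Fin.append_right])
  have hmem : ∀ p, p ∈ E ↔
      p ∈ E₁.map (Prod.map (Sum.map id (Fin.castAdd m₂)) (Sum.map id (Fin.castAdd m₂))) ∨
        p ∈ E₂.map (Prod.map (Sum.map id (Fin.natAdd m₁)) (Sum.map id (Fin.natAdd m₁))) := by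
    intro p
    rw [hE, Multiset.mem_add]
  refine ⟨?_, ?_, ?_, ?_, ?_, ?_⟩
  · intro j
    induction j using Fin.addCases with
    | left j => exact A1 j
    | right j => exact B1 j
  · intro j j' h
    induction j using Fin.addCases with
    | left j => exact A2 j j' h
    | right j => exact B2 j j' h
  · intro j b h
    rcases h with h | h
    · rcases (hmem _).1 h with h | h
      · exact A3a j b (Or.inl h)
      · exact B3a j b (Or.inl h)
    · rcases (hmem _).1 h with h | h
      · exact A3a j b (Or.inr h)
      · exact B3a j b (Or.inr h)
  · intro j j' h hjj'
    rcases h with h | h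
    · rcases (hmem _).1 h with h | h
      · exact A3b j j' (Or.inl h) hjj'
      · exact B3b j j' (Or.inl h) hjj'
    · rcases (hmem _).1 h with h | h
      · exact A3b j j' (Or.inr h) hjj'
      · exact B3b j j' (Or.inr h) hjj'
  · intro j j₁ j₂ h₁ h₂ hlt
    induction j using Fin.addCases with
    | left j => exact A4a j j₁ j₂ h₁ h₂ hlt
    | right j => exact B4a j j₁ j₂ h₁ h₂ hlt
  · intro j j₁ b h₁ hb
    induction j using Fin.addCases with
    | left j => exact A4b j j₁ b h₁ hb
    | right j => exact B4b j j₁ b h₁ hb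

/-! ### Forgetting a label -/

/-- **Forgetting label `a`** (the `sumLabel a` of one-sorted expressions): the vertex holding label `a`
becomes the NEW inner vertex `Fin.natAdd m 0 : Fin (m + 1)` — created before every inner vertex of the
sub-pattern, hence LAST among the inner vertices in the reversed creation order — whose designated higher
neighbours are the other `k - 1` label vertices, and a fresh isolated vertex takes label `a`; this preserves
the certificate. [folklore] -/
theorem certificate_forget (a : Fin k) (E : Multiset ((Fin k ⊕ Fin m) × (Fin k ⊕ Fin m)))
    (N : Fin m → Finset (Fin k ⊕ Fin m))
    (h1 : ∀ j, (N j).card ≤ k - 1)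
    (h2 : ∀ j j', Sum.inr j' ∈ N j → j < j')
    (h3a : ∀ (j : Fin m) (b : Fin k),
      ((Sum.inr j, Sum.inl b) ∈ E ∨ (Sum.inl b, Sum.inr j) ∈ E) → Sum.inl b ∈ N j)
    (h3b : ∀ j j' : Fin m,
      ((Sum.inr j, Sum.inr j') ∈ E ∨ (Sum.inr j', Sum.inr j) ∈ E) → j < j' → Sum.inr j' ∈ N j)
    (h4a : ∀ j j₁ j₂ : Fin m, Sum.inr j₁ ∈ N j → Sum.inr j₂ ∈ N j → j₁ < j₂ → Sum.inr j₂ ∈ N j₁)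
    (h4b : ∀ (j j₁ : Fin m) (b : Fin k), Sum.inr j₁ ∈ N j → Sum.inl b ∈ N j → Sum.inl b ∈ N j₁)
    (E' : Multiset ((Fin k ⊕ Fin (m + 1)) × (Fin k ⊕ Fin (m + 1))))
    (hE' : E' = E.map (Prod.map
      (Sum.elim (fun b => if b = a then Sum.inr (Fin.natAdd m 0) else Sum.inl b)
        (fun j => Sum.inr (Fin.castAdd 1 j)))
      (Sum.elim (fun b => if b = a then Sum.inr (Fin.natAdd m 0) else Sum.inl b)
        (fun j => Sum.inr (Fin.castAdd 1 j)))))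
    (N' : Fin (m + 1) → Finset (Fin k ⊕ Fin (m + 1)))
    (hN' : N' = Fin.append
      (fun j => (N j).image (Sum.elim (fun b => if b = a then Sum.inr (Fin.natAdd m 0) else Sum.inl b)
        (fun j => Sum.inr (Fin.castAdd 1 j))))
      (fun _ => (Finset.univ.erase a).image Sum.inl)) :
    (∀ j, (N' j).card ≤ k - 1) ∧
    (∀ j j', Sum.inr j' ∈ N' j → j < j') ∧
    (∀ (j : Fin (m + 1)) (b : Fin k),
      ((Sum.inr j, Sum.inl b) ∈ E' ∨ (Sum.inl b, Sum.inr j) ∈ E') → Sum.inl b ∈ N' j) ∧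
    (∀ j j' : Fin (m + 1),
      ((Sum.inr j, Sum.inr j') ∈ E' ∨ (Sum.inr j', Sum.inr j) ∈ E') → j < j' → Sum.inr j' ∈ N' j) ∧
    (∀ j j₁ j₂ : Fin (m + 1), Sum.inr j₁ ∈ N' j → Sum.inr j₂ ∈ N' j → j₁ < j₂ → Sum.inr j₂ ∈ N' j₁) ∧
    (∀ (j j₁ : Fin (m + 1)) (b : Fin k), Sum.inr j₁ ∈ N' j → Sum.inl b ∈ N' j → Sum.inl b ∈ N' j₁) := by
  set ψ : Fin k ⊕ Fin m → Fin k ⊕ Fin (m + 1) :=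
    Sum.elim (fun b => if b = a then Sum.inr (Fin.natAdd m 0) else Sum.inl b)
      (fun j => Sum.inr (Fin.castAdd 1 j)) with hψ
  -- values and inversion of `ψ`
  have hψa : ψ (Sum.inl a) = Sum.inr (Fin.natAdd m 0) := by simp [hψ]
  have hψb : ∀ b, b ≠ a → ψ (Sum.inl b) = Sum.inl b := fun b hb => by simp [hψ, hb]
  have hψj : ∀ j, ψ (Sum.inr j) = Sum.inr (Fin.castAdd 1 j) := fun j => rfl
  have hψl : ∀ (x : Fin k ⊕ Fin m) (b : Fin k), ψ x = Sum.inl b → x = Sum.inl b ∧ b ≠ a := by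
    rintro (b' | j) b h
    · by_cases hb' : b' = a
      · subst hb'
        rw [hψa] at h
        exact absurd h Sum.inr_ne_inl
      · rw [hψb b' hb'] at h
        obtain rfl := Sum.inl_injective h
        exact ⟨rfl, hb'⟩
    · rw [hψj] at h
      exact absurd h Sum.inr_ne_inl
  have hψr : ∀ (x : Fin k ⊕ Fin m) (j' : Fin (m + 1)), ψ x = Sum.inr j' →
      (x = Sum.inl a ∧ j' = Fin.natAdd m 0) ∨ (∃ j, x = Sum.inr j ∧ j' = Fin.castAdd 1 j) := by
    rintro (b | j) j' h
    · by_cases hb : b = a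
      · subst hb
        rw [hψa] at h
        exact Or.inl ⟨rfl, (Sum.inr_injective h).symm⟩
      · rw [hψb b hb] at h
        exact absurd h Sum.inl_ne_inr
    · rw [hψj] at h
      exact Or.inr ⟨j, rfl, (Sum.inr_injective h).symm⟩
  -- order facts for the new inner vertex
  have hlt_new : ∀ j : Fin m, Fin.castAdd 1 j < Fin.natAdd m 0 := by
    intro j
    rw [Fin.lt_def, Fin.val_castAdd, Fin.val_natAdd]
    have := j.isLt
    omega
  have not_new_lt : ∀ j' : Fin (m + 1), ¬ Fin.natAdd m 0 < j' := by
    intro j'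
    rw [Fin.lt_def, Fin.val_natAdd]
    have := j'.isLt
    simp only [Fin.val_zero]
    omega
  -- the certificate sets
  have hmem_old : ∀ (j : Fin m) (y : Fin k ⊕ Fin (m + 1)),
      y ∈ N' (Fin.castAdd 1 j) ↔ ∃ x ∈ N j, ψ x = y := by
    intro j y
    rw [hN', Fin.append_left, Finset.mem_image]
  have hmem_new : ∀ (i : Fin 1) (y : Fin k ⊕ Fin (m + 1)),
      y ∈ N' (Fin.natAdd m i) ↔ ∃ b, b ≠ a ∧ Sum.inl b = y := by
    intro i y
    rw [hN', Fin.append_right, Finset.mem_image]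
    simp
  have hmemE : ∀ x y : Fin k ⊕ Fin (m + 1), (x, y) ∈ E' → ∃ u v, (u, v) ∈ E ∧ ψ u = x ∧ ψ v = y := by
    intro x y h
    rw [hE'] at h
    obtain ⟨⟨u, v⟩, he, huv⟩ := Multiset.mem_map.1 h
    simp only [Prod.map_apply, Prod.mk.injEq] at huv
    exact ⟨u, v, he, huv.1, huv.2⟩
  refine ⟨?_, ?_, ?_, ?_, ?_, ?_⟩
  · intro j
    induction j using Fin.addCases with
    | left j =>
      rw [hN', Fin.append_left]
      exact Finset.card_image_le.trans (h1 j)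
    | right i =>
      rw [hN', Fin.append_right, Finset.card_image_of_injective _ Sum.inl_injective,
        Finset.card_erase_of_mem (Finset.mem_univ a), Finset.card_univ, Fintype.card_fin]
  · intro j j' h
    induction j using Fin.addCases with
    | left j₀ =>
      obtain ⟨x, hx, hxy⟩ := (hmem_old j₀ _).1 h
      rcases hψr x j' hxy with ⟨rfl, rfl⟩ | ⟨j₁, rfl, rfl⟩
      · exact hlt_new j₀
      · exact Fin.strictMono_castAdd 1 (h2 j₀ j₁ hx)
    | right i =>
      obtain ⟨b, -, hb⟩ := (hmem_new i _).1 h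
      exact absurd hb Sum.inl_ne_inr
  · intro j b h
    rcases h with h | h
    · obtain ⟨u, v, he, hu, hv⟩ := hmemE _ _ h
      obtain ⟨rfl, hba⟩ := hψl v b hv
      rcases hψr u j hu with ⟨rfl, rfl⟩ | ⟨j₀, rfl, rfl⟩
      · exact (hmem_new 0 _).2 ⟨b, hba, rfl⟩
      · exact (hmem_old j₀ _).2 ⟨Sum.inl b, h3a j₀ b (Or.inl he), hψb b hba⟩
    · obtain ⟨u, v, he, hu, hv⟩ := hmemE _ _ h
      obtain ⟨rfl, hba⟩ := hψl u b hu
      rcases hψr v j hv with ⟨rfl, rfl⟩ | ⟨j₀, rfl, rfl⟩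
      · exact (hmem_new 0 _).2 ⟨b, hba, rfl⟩
      · exact (hmem_old j₀ _).2 ⟨Sum.inl b, h3a j₀ b (Or.inr he), hψb b hba⟩
  · intro j j' h hjj'
    rcases h with h | h
    · obtain ⟨u, v, he, hu, hv⟩ := hmemE _ _ h
      rcases hψr u j hu with ⟨rfl, rfl⟩ | ⟨j₀, rfl, rfl⟩
      · exact absurd hjj' (not_new_lt j')
      · rcases hψr v j' hv with ⟨rfl, rfl⟩ | ⟨j₁, rfl, rfl⟩
        · exact (hmem_old j₀ _).2 ⟨Sum.inl a, h3a j₀ a (Or.inl he), hψa⟩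
        · exact (hmem_old j₀ _).2 ⟨Sum.inr j₁,
            h3b j₀ j₁ (Or.inl he) ((Fin.strictMono_castAdd 1).lt_iff_lt.1 hjj'), hψj j₁⟩
    · obtain ⟨u, v, he, hu, hv⟩ := hmemE _ _ h
      rcases hψr v j hv with ⟨rfl, rfl⟩ | ⟨j₀, rfl, rfl⟩
      · exact absurd hjj' (not_new_lt j')
      · rcases hψr u j' hu with ⟨rfl, rfl⟩ | ⟨j₁, rfl, rfl⟩
        · exact (hmem_old j₀ _).2 ⟨Sum.inl a, h3a j₀ a (Or.inr he), hψa⟩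
        · exact (hmem_old j₀ _).2 ⟨Sum.inr j₁,
            h3b j₀ j₁ (Or.inr he) ((Fin.strictMono_castAdd 1).lt_iff_lt.1 hjj'), hψj j₁⟩
  · intro j j₁ j₂ h₁ h₂ hlt
    induction j using Fin.addCases with
    | left j₀ =>
      obtain ⟨x₁, hx₁, e₁⟩ := (hmem_old j₀ _).1 h₁
      obtain ⟨x₂, hx₂, e₂⟩ := (hmem_old j₀ _).1 h₂
      rcases hψr x₁ j₁ e₁ with ⟨rfl, rfl⟩ | ⟨i₁, rfl, rfl⟩
      · exact absurd hlt (not_new_lt j₂)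
      · rcases hψr x₂ j₂ e₂ with ⟨rfl, rfl⟩ | ⟨i₂, rfl, rfl⟩
        · exact (hmem_old i₁ _).2 ⟨Sum.inl a, h4b j₀ i₁ a hx₁ hx₂, hψa⟩
        · exact (hmem_old i₁ _).2 ⟨Sum.inr i₂,
            h4a j₀ i₁ i₂ hx₁ hx₂ ((Fin.strictMono_castAdd 1).lt_iff_lt.1 hlt), hψj i₂⟩
    | right i =>
      obtain ⟨b, -, hb⟩ := (hmem_new i _).1 h₁
      exact absurd hb Sum.inl_ne_inr
  · intro j j₁ b h₁ hb
    induction j using Fin.addCases with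
    | left j₀ =>
      obtain ⟨x₁, hx₁, e₁⟩ := (hmem_old j₀ _).1 h₁
      obtain ⟨x, hx, ex⟩ := (hmem_old j₀ _).1 hb
      obtain ⟨rfl, hba⟩ := hψl x b ex
      rcases hψr x₁ j₁ e₁ with ⟨rfl, rfl⟩ | ⟨i₁, rfl, rfl⟩
      · exact (hmem_new 0 _).2 ⟨b, hba, rfl⟩
      · exact (hmem_old i₁ _).2 ⟨Sum.inl b, h4b j₀ i₁ b hx₁ hx, hψb b hba⟩
    | right i =>
      obtain ⟨b', -, hb'⟩ := (hmem_new i _).1 h₁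
      exact absurd hb' Sum.inl_ne_inr

end Summit.ValiantsHypothesis.ValiantsHypothesis.Theorems.DiUnfolding

end
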